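import Summits.FinalStateConjecture.FinalStateConjecture.Theorems.BartnikGapSettlingBondiBartnikRigiditySlabFrontierCausalClocks
import Literature.Geometry.Lorentzian.CausalCurveEndpoint
import Literature.Geometry.Lorentzian.IdealPoints
import Literature.Geometry.Lorentzian.SubdevelopmentUnionCauchy
import Literature.Geometry.Lorentzian.KerrConvergenceProofs
import HarnessLib

/-!
# K2b-5 `stub_marchingLemma`, brick 2: the level slice is a Cauchy hypersurface of its KITE — line
# `direct-method-on-the-cone` (crux `BondiBartnikRigidity`, stmt-FinalStateConjecture-10807)

The Kerr-side geometric input of one marching step (report K2b-a2 §4, "the Kerr KITE over `Σ_τ`").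
In the ingoing Kerr–Schild star chart `Kerr.region a M = {r > M}` (`0 < M`, `|a| < M`) fix a level
`σ`, an open set of spatial points `S ⊆ E3` (the slice piece `Σ = {σ} × S`), heights `h⁺, h⁻`, and an
open FUTURE SET `W` of the chart (`I⁺(x) ⊆ W` for `x ∈ W`).  The KITE over `Σ` is `K = K⁺ ∪ K⁻`,

* `K⁺ = {σ ≤ t* < σ + h⁺, every z with ‖z − x̂‖ ≤ t* − σ and r(z) ≥ min (r(x), r₊) lies in S}` —
  erosion of `S` at unit coordinate speed, except that inside the black hole the past cone is cut at
  the radius of its vertex (the hole clock: `r` does not decrease pastward while `r < r₊`);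
* `K⁻ = W ∩ {σ − h⁻ < t* < σ, t* + (2/3) r > σ + (2/3) M, every z with ‖z − x̂‖ ≤ σ − t* lies in S}` —
  erosion of `S` pastward, the clock `t* + (2/3) r` keeping future curves off the chart edge `r = M`.

Main result (`kite_cauchy_chart`, chart form, the kite handed over by its membership predicate as in
`KerrLens.lens_cauchy_chart`): every future timelike curve of the chart lying in `K` without future
or past endpoint in `K` meets the level `{t* = σ}` exactly once.  Uniqueness: `t*` is a time function.
Existence by the escape dichotomy: above the level the coordinate curve has a past endpoint `q` (the
time is bounded below; Minkowski endpoint lemma through the cone comparison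
`CollarCauchy.minkowski_curve`), and the cone condition of `K⁺` PASSES TO `q` — the integrated speed
limit `‖x̂(s) − q̂‖ ≤ t*(s) − t*(q)` (`Minkowski.norm_spatial_sub_le`) and the integrated hole clock
`r(q) ≥ min (r(γ s), r₊)` (`KerrCausal.radius_le_of_radius_lt_rPlus`) put the cone of `q` inside the
cone of `γ s`; below the level the future endpoint `q` inherits the cone condition of `K⁻` likewise,
lies in `W` (a future endpoint of a timelike curve of `W` is in `I⁺` of its points,
`mem_chronologicalPast_of_hasFutureEndpoint`) and off the edge by the clock.  So `q ∈ K`: contradiction.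

References: O'Neill 1983, Ch. 14, Def. 14.28, Cor. 14.1 [ONeill1983]; Hawking–Ellis 1973, §6.2, §6.5
[HawkingEllis1973CUP]; Dafermos–Rodnianski arXiv:0811.0354, §5.1 [DafermosRodnianski2008].
No definitions, no named facts.
-/

noncomputable section

-- D-0017: single-problem summit, `Summit.<S>.<S>.…` by design (cf. lakefile `weak.linter.dupNamespace`).
set_option linter.dupNamespace false

open Set Filter Function Topology TopologicalSpace
open Literature.Geometry.Lorentzian
open scoped Manifold ContDiff Topology
open Summit.FinalStateConjecture.FinalStateConjecture.Theorems.SwallowTheDatum.KerrShieldedSettles.CollarCauchy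
  (minkowski_curve)

namespace Summit.FinalStateConjecture.FinalStateConjecture.Theorems.BondiBartnikRigidity.DirectMethod

namespace KerrKite

open F1Route (strictMonoOn_clock strictMonoOn_time' rMinus_lt_self self_lt_rPlus)

variable [Kerr.Facts] {M a : ℝ} {hM : 0 ≤ M} {γ : ℝ → Kerr.region a M} {s : Set ℝ}

/-! ### Limit forms of the speed limit and of the hole clock at an endpoint -/

/-- **Integrated speed limit up to a future endpoint**: if the coordinate curve of a future timelike
curve of the chart (on an interval) has the future endpoint `q`, then `‖q̂ − x̂(t₀)‖ ≤ t*(q) − t*(γ t₀)`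
(`Minkowski.norm_spatial_sub_le` in the limit). [cite: ONeill1983, Ch. 14, Def. 14.28] -/
theorem norm_spatial_sub_le_of_hasFutureEndpoint (hs : s.OrdConnected)
    (hγ : (Kerr.smoothMetric M a M).IsFutureTimelikeCurveOn ((Kerr.timeOrientation M a M hM).ofLE le_top) γ s)
    {q : E4} (hq : HasFutureEndpoint (fun σ => (γ σ : E4)) s q) {t₀ : ℝ} (ht₀ : t₀ ∈ s) :
    ‖E4.spatial q - E4.spatial (γ t₀ : E4)‖ ≤ q 0 - (γ t₀ : E4) 0 := by
  haveI : Nonempty s := ⟨⟨t₀, ht₀⟩⟩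
  have hβ := minkowski_curve hγ
  have hc0 : Continuous fun x : E4 => x 0 := PiLp.continuous_apply 2 _ 0
  have h1 : Tendsto (fun σ : s => ‖E4.spatial (γ σ : E4) - E4.spatial (γ t₀ : E4)‖) atTop
      (𝓝 ‖E4.spatial q - E4.spatial (γ t₀ : E4)‖) :=
    ((continuous_norm.comp (E4.spatial.continuous.sub continuous_const)).tendsto q).comp hq
  have h2 : Tendsto (fun σ : s => (γ σ : E4) 0 - (γ t₀ : E4) 0) atTop (𝓝 (q 0 - (γ t₀ : E4) 0)) :=
    ((hc0.sub continuous_const).tendsto q).comp hq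
  refine le_of_tendsto_of_tendsto h1 h2 ?_
  filter_upwards [eventually_ge_atTop (⟨t₀, ht₀⟩ : s)] with σ hσ
  exact Minkowski.norm_spatial_sub_le hs hβ ht₀ σ.2 hσ

/-- **Integrated speed limit down to a past endpoint**: `‖x̂(t₀) − q̂‖ ≤ t*(γ t₀) − t*(q)` for a past
endpoint `q` of the coordinate curve. [cite: ONeill1983, Ch. 14, Def. 14.28] -/
theorem norm_spatial_sub_le_of_hasPastEndpoint (hs : s.OrdConnected)
    (hγ : (Kerr.smoothMetric M a M).IsFutureTimelikeCurveOn ((Kerr.timeOrientation M a M hM).ofLE le_top) γ s)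
    {q : E4} (hq : HasPastEndpoint (fun σ => (γ σ : E4)) s q) {t₀ : ℝ} (ht₀ : t₀ ∈ s) :
    ‖E4.spatial (γ t₀ : E4) - E4.spatial q‖ ≤ (γ t₀ : E4) 0 - q 0 := by
  haveI : Nonempty s := ⟨⟨t₀, ht₀⟩⟩
  have hβ := minkowski_curve hγ
  have hc0 : Continuous fun x : E4 => x 0 := PiLp.continuous_apply 2 _ 0
  have h1 : Tendsto (fun σ : s => ‖E4.spatial (γ t₀ : E4) - E4.spatial (γ σ : E4)‖) atBot
      (𝓝 ‖E4.spatial (γ t₀ : E4) - E4.spatial q‖) :=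
    ((continuous_norm.comp (continuous_const.sub E4.spatial.continuous)).tendsto q).comp hq
  have h2 : Tendsto (fun σ : s => (γ t₀ : E4) 0 - (γ σ : E4) 0) atBot (𝓝 ((γ t₀ : E4) 0 - q 0)) :=
    ((continuous_const.sub hc0).tendsto q).comp hq
  refine le_of_tendsto_of_tendsto h1 h2 ?_
  filter_upwards [eventually_le_atBot (⟨t₀, ht₀⟩ : s)] with σ hσ
  exact Minkowski.norm_spatial_sub_le hs hβ σ.2 ht₀ hσ

/-- **Integrated hole clock down to a past endpoint**: `r(q) ≥ min (r(γ t₀), r₊)` for a past endpoint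
`q` of the coordinate curve of a future timelike curve of the chart `{r > M}`, `|a| < M` (a future
causal curve starting inside `{r < r₊}` never exceeds its initial radius,
`KerrCausal.radius_le_of_radius_lt_rPlus`, so `r(γ t') ≥ min (r(γ t₀), r₊)` for `t' ≤ t₀`; pass to
the limit). [cite: ONeill1995, Ch. 2] -/
theorem min_radius_rPlus_le_of_hasPastEndpoint (ha : |a| < M) (hs : s.OrdConnected)
    (hγ : (Kerr.smoothMetric M a M).IsFutureTimelikeCurveOn ((Kerr.timeOrientation M a M hM).ofLE le_top) γ s)
    {q : E4} (hq : HasPastEndpoint (fun σ => (γ σ : E4)) s q) {t₀ : ℝ} (ht₀ : t₀ ∈ s) :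
    min (Kerr.radius a (γ t₀ : E4)) (Kerr.rPlus M a) ≤ Kerr.radius a q := by
  haveI : Nonempty s := ⟨⟨t₀, ht₀⟩⟩
  have hqr : Tendsto (fun σ : s => Kerr.radius a (γ σ : E4)) atBot (𝓝 (Kerr.radius a q)) :=
    ((Kerr.continuous_radius a).tendsto q).comp hq
  refine ge_of_tendsto hqr ?_
  filter_upwards [eventually_le_atBot (⟨t₀, ht₀⟩ : s)] with σ hσ
  by_cases hlt : Kerr.radius a (γ σ : E4) < Kerr.rPlus M a
  · have hγ' := hγ.isFutureCausalCurveOn.mono (hs.out σ.2 ht₀)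
    exact (min_le_left _ _).trans
      (KerrCausal.radius_le_of_radius_lt_rPlus ha hγ' hlt t₀ (right_mem_Icc.2 hσ))
  · exact (min_le_right _ _).trans (not_lt.1 hlt)

/-- **The clock `t* + (2/3) r` up to a future endpoint**: it is increasing along the curve
(`F1Route.strictMonoOn_clock`), hence bounded above by its value at a future endpoint `q`.
[cite: DafermosRodnianski2008, §5.1] -/
theorem clock_le_of_hasFutureEndpoint (ha : |a| < M) (hs : s.OrdConnected)
    (hγ : (Kerr.smoothMetric M a M).IsFutureTimelikeCurveOn ((Kerr.timeOrientation M a M hM).ofLE le_top) γ s)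
    {q : E4} (hq : HasFutureEndpoint (fun σ => (γ σ : E4)) s q) {t₀ : ℝ} (ht₀ : t₀ ∈ s) :
    (γ t₀ : E4) 0 + 2 / 3 * Kerr.radius a (γ t₀ : E4) ≤ q 0 + 2 / 3 * Kerr.radius a q := by
  haveI : Nonempty s := ⟨⟨t₀, ht₀⟩⟩
  have hc0 : Continuous fun x : E4 => x 0 := PiLp.continuous_apply 2 _ 0
  have hw := strictMonoOn_clock (c := 2 / 3) (by rw [abs_of_pos (by norm_num)]) ha hs hγ
  have hqr : Tendsto (fun σ : s => Kerr.radius a (γ σ : E4)) atTop (𝓝 (Kerr.radius a q)) :=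
    ((Kerr.continuous_radius a).tendsto q).comp hq
  have hq0 : Tendsto (fun σ : s => (γ σ : E4) 0) atTop (𝓝 (q 0)) := (hc0.tendsto q).comp hq
  refine ge_of_tendsto (hq0.add (hqr.const_mul (2 / 3))) ?_
  filter_upwards [eventually_ge_atTop (⟨t₀, ht₀⟩ : s)] with σ hσ
  exact hw.monotoneOn ht₀ σ.2 hσ

omit [Kerr.Facts] in
/-- The radius of a spatial point `z`, read at level `0`, is the radius of any point of `E4` with
spatial part `z`. [folklore] -/
theorem radius_ofTimeSpace_zero_eq {x : E4} {z : E3} (h : E4.spatial x = z) :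
    Kerr.radius a (E4.ofTimeSpace 0 z) = Kerr.radius a x :=
  Kerr.radius_eq_of_spatial_eq a (by rw [E4.spatial_ofTimeSpace, h])

/-! ### The Cauchy property of the level slice in its kite, chart form -/

/-- **The level `{t* = σ}` is met exactly once by every future timelike curve of the chart lying in
the kite `K = K⁺ ∪ K⁻` and without future/past endpoint in `K`** (chart form; the kite is handed over
through its two membership predicates, and `W` is any future set of the chart containing `K⁻`).
Uniqueness by the monotonicity of `t*`; existence by the escape dichotomy described in the module
docstring: the cone conditions of `K⁺` / `K⁻` pass to the past / future endpoint of the coordinate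
curve, which therefore lies in `K`. [cite: ONeill1983, Ch. 14, Def. 14.28] -/
theorem kite_cauchy_chart {M a : ℝ} (hM0 : 0 < M) (ha : |a| < M) {S : Set E3}
    {W : Set (Kerr.region a M)} {σ hp hm : ℝ} (hhp : 0 < hp)
    (hW : ∀ x ∈ W, (Kerr.smoothMetric M a M).chronologicalFuture
      ((Kerr.timeOrientation M a M hM0.le).ofLE le_top) {x} ⊆ W)
    (γ : ℝ → Kerr.region a M) (s : Set ℝ) (hs : s.OrdConnected) (hne : s.Nonempty)
    (hγ : (Kerr.smoothMetric M a M).IsFutureTimelikeCurveOn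
      ((Kerr.timeOrientation M a M hM0.le).ofLE le_top) γ s)
    (hK : ∀ t ∈ s,
      (σ ≤ (γ t : E4) 0 ∧ (γ t : E4) 0 < σ + hp ∧ ∀ z : E3, ‖z - E4.spatial (γ t : E4)‖ ≤ (γ t : E4) 0 - σ →
        min (Kerr.radius a (γ t : E4)) (Kerr.rPlus M a) ≤ Kerr.radius a (E4.ofTimeSpace 0 z) → z ∈ S) ∨
      (γ t ∈ W ∧ σ - hm < (γ t : E4) 0 ∧ (γ t : E4) 0 < σ ∧
        σ + 2 / 3 * M < (γ t : E4) 0 + 2 / 3 * Kerr.radius a (γ t : E4) ∧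
        ∀ z : E3, ‖z - E4.spatial (γ t : E4)‖ ≤ σ - (γ t : E4) 0 → z ∈ S))
    (hend : ∀ q : Kerr.region a M,
      ((σ ≤ (q : E4) 0 ∧ (q : E4) 0 < σ + hp ∧ ∀ z : E3, ‖z - E4.spatial (q : E4)‖ ≤ (q : E4) 0 - σ →
        min (Kerr.radius a (q : E4)) (Kerr.rPlus M a) ≤ Kerr.radius a (E4.ofTimeSpace 0 z) → z ∈ S) ∨
      (q ∈ W ∧ σ - hm < (q : E4) 0 ∧ (q : E4) 0 < σ ∧
        σ + 2 / 3 * M < (q : E4) 0 + 2 / 3 * Kerr.radius a (q : E4) ∧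
        ∀ z : E3, ‖z - E4.spatial (q : E4)‖ ≤ σ - (q : E4) 0 → z ∈ S)) →
      ¬ HasFutureEndpoint γ s q ∧ ¬ HasPastEndpoint γ s q)
    (hnomax : ∀ t ∈ s, ∃ t' ∈ s, t < t') :
    ∃! t, t ∈ s ∧ (γ t : E4) 0 = σ := by
  haveI : Nonempty s := hne.to_subtype
  -- the Levi-Civita instances of the Kerr metric, consumed by the endpoint lemma
  haveI : Fact ((1 : ℕ∞ω) ≤ ∞) := ⟨by exact_mod_cast le_top⟩
  haveI : (Kerr.smoothMetric M a M).HasLeviCivita := PseudoRiemannianMetric.hasLeviCivita _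
  haveI : CovariantDerivative.ContMDiffCovariantDerivative (Kerr.smoothMetric M a M).leviCivita 1 :=
    ⟨(Kerr.smoothMetric M a M).toPseudoRiemannianMetric.isLocallyContMDiff_leviCivita_holds 1
      (by rw [show ((1 : ℕ∞) : ℕ∞ω) + 1 = 2 by norm_num]; exact WithTop.coe_le_coe.2 le_top)
      univ isOpen_univ⟩
  have hβ := minkowski_curve hγ
  have hmono := strictMonoOn_time' hs hγ
  have hmem : ∀ q : E4, M < Kerr.radius a q → q ∈ Kerr.region a M := fun q hq => by
    rw [Kerr.mem_region, max_eq_left hM0.le]; exact hq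
  have hn : ((⊤ : ℕ∞) : ℕ∞ω) ≤ (⊤ : ℕ∞) := le_rfl
  -- uniqueness by monotonicity of `t*`; existence is what remains
  suffices hex : ∃ t ∈ s, (γ t : E4) 0 = σ by
    obtain ⟨t, ht, ht0⟩ := hex
    refine ⟨t, ⟨ht, ht0⟩, ?_⟩
    rintro t' ⟨ht', ht'0⟩
    exact hmono.injOn ht' ht (ht'0.trans ht0.symm)
  by_contra hno
  push Not at hno
  obtain ⟨t₀, ht₀⟩ := hne
  have hcont : ContinuousOn (fun σ => (γ σ : E4) 0) s := Minkowski.continuousOn_time hβ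
  have hc0 : Continuous fun q : E4 => q 0 := PiLp.continuous_apply 2 _ 0
  rcases lt_or_gt_of_ne (hno t₀ ht₀) with hneg | hpos
  · /- below the level: the curve lies in `K⁻`; futureward escape.  `t* < σ` on `s`, so the coordinate
      curve has a future endpoint `q`; `q ∈ W` (future set), the clock puts `q` off the edge, and the
      cone condition of `K⁻` passes to `q`: `q ∈ K`, contradiction. -/
    have hall : ∀ t ∈ s, (γ t : E4) 0 < σ := by
      intro t ht
      by_contra hge
      push Not at hge
      obtain ⟨c, hc, hc0'⟩ := hs.isPreconnected.intermediate_value ht₀ ht hcont ⟨hneg.le, hge⟩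
      exact hno c hc hc0'
    have hlow : ∀ t ∈ s, γ t ∈ W ∧ σ - hm < (γ t : E4) 0 ∧ (γ t : E4) 0 < σ ∧
        σ + 2 / 3 * M < (γ t : E4) 0 + 2 / 3 * Kerr.radius a (γ t : E4) ∧
        ∀ z : E3, ‖z - E4.spatial (γ t : E4)‖ ≤ σ - (γ t : E4) 0 → z ∈ S := by
      intro t ht
      rcases hK t ht with h | h
      · exact absurd h.1 (not_le.2 (hall t ht))
      · exact h
    have hbdd : BddAbove ((fun σ => (γ σ : E4) 0) '' s) :=
      ⟨σ, by rintro _ ⟨σ', hσ', rfl⟩; exact (hall σ' hσ').le⟩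
    obtain ⟨q, hq⟩ : ∃ q : E4, HasFutureEndpoint (fun σ => (γ σ : E4)) s q := by
      by_contra hcon
      push Not at hcon
      exact Minkowski.not_bddAbove_time hs hβ ⟨⟨t₀, ht₀⟩, hcon⟩ hbdd
    have hq0 : Tendsto (fun σ : s => (γ σ : E4) 0) atTop (𝓝 (q 0)) := (hc0.tendsto q).comp hq
    have hq0le : q 0 ≤ σ := le_of_tendsto' hq0 fun σ' => (hall σ' σ'.2).le
    have hq0ge : (γ t₀ : E4) 0 ≤ q 0 := by
      refine ge_of_tendsto hq0 ?_
      filter_upwards [eventually_ge_atTop (⟨t₀, ht₀⟩ : s)] with σ' hσ'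
      exact hmono.monotoneOn ht₀ σ'.2 hσ'
    have hclock := clock_le_of_hasFutureEndpoint ha hs hγ hq ht₀
    obtain ⟨hW₀, hm₀, -, hcl₀, -⟩ := hlow t₀ ht₀
    have hrq : M < Kerr.radius a q := by linarith
    set q' : Kerr.region a M := ⟨q, hmem q hrq⟩ with hq'
    have hq' : HasFutureEndpoint γ s q' := (hasFutureEndpoint_subtypeVal_comp_iff (p := q')).1 hq
    -- `q ∈ W`: a future endpoint of a timelike curve of `W` lies in `I⁺` of its points
    obtain ⟨t₁, ht₁, ht₀₁⟩ := hnomax t₀ ht₀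
    have hqW : q' ∈ W := by
      have h := LorentzianMetric.mem_chronologicalPast_of_hasFutureEndpoint
        ((Kerr.timeOrientation M a M hM0.le).ofLE le_top) hn hs hγ hq' ht₀ ht₁ ht₀₁
      exact hW _ hW₀ (LorentzianMetric.mem_chronologicalFuture_of_mem_chronologicalPast h)
    -- the cone condition passes to `q`
    have hcone : ∀ z : E3, ‖z - E4.spatial q‖ ≤ σ - q 0 → z ∈ S := by
      intro z hz
      have hsp := norm_spatial_sub_le_of_hasFutureEndpoint hs hγ hq ht₀
      refine (hlow t₀ ht₀).2.2.2.2 z ?_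
      calc ‖z - E4.spatial (γ t₀ : E4)‖
          ≤ ‖z - E4.spatial q‖ + ‖E4.spatial q - E4.spatial (γ t₀ : E4)‖ := norm_sub_le_norm_sub_add_norm_sub _ _ _
        _ ≤ σ - (γ t₀ : E4) 0 := by linarith
    refine (hend q' ?_).1 hq'
    rcases hq0le.lt_or_eq with hlt | heq
    · exact Or.inr ⟨hqW, by show σ - hm < q 0; linarith, hlt, by show σ + 2 / 3 * M < q 0 + _; linarith,
        hcone⟩
    · refine Or.inl ⟨heq.ge, by show q 0 < σ + hp; linarith, ?_⟩
      intro z hz _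
      have hz' : ‖z - E4.spatial q‖ ≤ q 0 - σ := hz
      exact hcone z (by linarith)
  · /- above the level: the curve lies in `K⁺ ∖ Σ`; pastward escape.  `t* > σ` on `s`, so the
      coordinate curve has a past endpoint `q`; the integrated speed limit and hole clock put the cone
      of `q` inside the cone of `γ t₀`, so `q ∈ K⁺`: contradiction. -/
    have hall : ∀ t ∈ s, σ < (γ t : E4) 0 := by
      intro t ht
      by_contra hle
      push Not at hle
      obtain ⟨c, hc, hc0'⟩ := hs.isPreconnected.intermediate_value ht ht₀ hcont ⟨hle, hpos.le⟩
      exact hno c hc hc0'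
    have hup : ∀ t ∈ s, σ ≤ (γ t : E4) 0 ∧ (γ t : E4) 0 < σ + hp ∧
        ∀ z : E3, ‖z - E4.spatial (γ t : E4)‖ ≤ (γ t : E4) 0 - σ →
          min (Kerr.radius a (γ t : E4)) (Kerr.rPlus M a) ≤ Kerr.radius a (E4.ofTimeSpace 0 z) → z ∈ S := by
      intro t ht
      rcases hK t ht with h | h
      · exact h
      · exact absurd h.2.2.1 (not_lt.2 (hall t ht).le)
    have hbdd : BddBelow ((fun σ => (γ σ : E4) 0) '' s) :=
      ⟨σ, by rintro _ ⟨σ', hσ', rfl⟩; exact (hall σ' hσ').le⟩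
    obtain ⟨q, hq⟩ : ∃ q : E4, HasPastEndpoint (fun σ => (γ σ : E4)) s q := by
      by_contra hcon
      push Not at hcon
      exact Minkowski.not_bddBelow_time hs hβ ⟨⟨t₀, ht₀⟩, hcon⟩ hbdd
    have hq0 : Tendsto (fun σ : s => (γ σ : E4) 0) atBot (𝓝 (q 0)) := (hc0.tendsto q).comp hq
    have hq0ge : σ ≤ q 0 := ge_of_tendsto' hq0 fun σ' => (hall σ' σ'.2).le
    have hq0le : q 0 ≤ (γ t₀ : E4) 0 := by
      refine le_of_tendsto hq0 ?_
      filter_upwards [eventually_le_atBot (⟨t₀, ht₀⟩ : s)] with σ' hσ'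
      exact hmono.monotoneOn σ'.2 ht₀ hσ'
    have hrmin := min_radius_rPlus_le_of_hasPastEndpoint ha hs hγ hq ht₀
    have hrq : M < Kerr.radius a q := by
      refine lt_of_lt_of_le (lt_min (Kerr.lt_radius_of_mem_region (γ t₀).2) (self_lt_rPlus ha)) hrmin
    set q' : Kerr.region a M := ⟨q, hmem q hrq⟩ with hq'
    have hq' : HasPastEndpoint γ s q' := (hasPastEndpoint_subtypeVal_comp_iff (p := q')).1 hq
    have hsp := norm_spatial_sub_le_of_hasPastEndpoint hs hγ hq ht₀
    refine (hend q' (Or.inl ⟨hq0ge, lt_of_le_of_lt hq0le (hup t₀ ht₀).2.1, fun z hz hrz => ?_⟩)).2 hq'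
    refine (hup t₀ ht₀).2.2 z ?_ (le_trans ?_ hrz)
    · calc ‖z - E4.spatial (γ t₀ : E4)‖
          ≤ ‖z - E4.spatial q‖ + ‖E4.spatial q - E4.spatial (γ t₀ : E4)‖ := norm_sub_le_norm_sub_add_norm_sub _ _ _
        _ = ‖z - E4.spatial q‖ + ‖E4.spatial (γ t₀ : E4) - E4.spatial q‖ := by rw [norm_sub_rev (E4.spatial q)]
        _ ≤ (γ t₀ : E4) 0 - σ := by linarith [show ‖z - E4.spatial q‖ ≤ q 0 - σ from hz]
    · -- `min (r(γ t₀), r₊) ≤ min (r q, r₊)`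
      exact le_min hrmin (min_le_right _ _)

/-! ### Packaged forms for the kite as an open sub-spacetime -/

section Packaged

variable {M a : ℝ} (hM0 : 0 < M) (ha : |a| < M) {S : Set E3} {W : Set (Kerr.region a M)}
  {σ hp hm : ℝ} (hhp : 0 < hp)
  (hW : ∀ x ∈ W, (Kerr.smoothMetric M a M).chronologicalFuture
    ((Kerr.timeOrientation M a M hM0.le).ofLE le_top) {x} ⊆ W)
  (U : Opens (Kerr.spacetime M a M hM0.le).carrier)
  (hU : ∀ y : Kerr.region a M, y ∈ U ↔
    (σ ≤ (y : E4) 0 ∧ (y : E4) 0 < σ + hp ∧ ∀ z : E3, ‖z - E4.spatial (y : E4)‖ ≤ (y : E4) 0 - σ →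
      min (Kerr.radius a (y : E4)) (Kerr.rPlus M a) ≤ Kerr.radius a (E4.ofTimeSpace 0 z) → z ∈ S) ∨
    (y ∈ W ∧ σ - hm < (y : E4) 0 ∧ (y : E4) 0 < σ ∧
      σ + 2 / 3 * M < (y : E4) 0 + 2 / 3 * Kerr.radius a (y : E4) ∧
      ∀ z : E3, ‖z - E4.spatial (y : E4)‖ ≤ σ - (y : E4) 0 → z ∈ S))
include hhp hW hU ha

/-- **The level slice `{t* = σ}` is a Cauchy hypersurface of the kite** (packaged form: every endless
timelike curve of the open sub-spacetime `K` of `Kerr.spacetime M a M` meets `val⁻¹' {t* = σ}` exactly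
once).  The kite enters as an abstract open set with its membership predicate.
[cite: ONeill1983, Ch. 14, Def. 14.28] -/
theorem isCauchyHypersurface_kite :
    ((Kerr.spacetime M a M hM0.le).metric.restrict PseudoRiemannianMetric.contMDiff_restrict_holds
        U).IsCauchyHypersurface
      ((Kerr.spacetime M a M hM0.le).timeOrientation.restrict
        PseudoRiemannianMetric.contMDiff_restrict_holds
        (Kerr.spacetime M a M hM0.le).timeOrientation.contMDiff_restrict_holds U)
      (Subtype.val ⁻¹' {y : Kerr.region a M | y.1 0 = σ}) := by
  intro γ s hγ
  obtain ⟨hs, htl, hfe, hpe⟩ := hγ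
  have htl' := (LorentzianMetric.isFutureTimelikeCurveOn_restrict_iff _ _ _ _ _).1 htl
  obtain ⟨t, ⟨hts, ht⟩, huniq⟩ := kite_cauchy_chart hM0 ha hhp hW (Subtype.val ∘ γ) s hs hfe.1 htl'
    (fun t _ => (hU _).1 (γ t).2)
    (fun q h => ⟨fun h' => hfe.2 ⟨q, (hU q).2 h⟩ (hasFutureEndpoint_subtypeVal_comp_iff.1 h'),
      fun h' => hpe.2 ⟨q, (hU q).2 h⟩ (hasPastEndpoint_subtypeVal_comp_iff.1 h')⟩)
    (fun t ht => hfe.exists_gt ht)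
  exact ⟨t, ⟨hts, ht⟩, fun t' ht' => huniq t' ⟨ht'.1, ht'.2⟩⟩

omit ha hhp hW in
/-- On the kite, the level slice consists of points of `Σ = {σ} × S`: a point of `K` with `t* = σ` has
its spatial part in `S` (it lies in `K⁺`, whose cone condition at radius `0` is membership in `S`).
[folklore] -/
theorem spatial_mem_of_mem_kite_of_time_eq {y : Kerr.region a M} (hy : y ∈ U) (ht : (y : E4) 0 = σ) :
    E4.spatial (y : E4) ∈ S := by
  rcases (hU y).1 hy with h | h
  · exact h.2.2 _ (by rw [sub_self, norm_zero, ht, sub_self])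
      (by rw [radius_ofTimeSpace_zero_eq rfl]; exact min_le_left _ _)
  · exact absurd h.2.2.1 (by rw [ht]; exact lt_irrefl σ)

end Packaged

end KerrKite

/-- **Registered bookkeeping sub-goal `stub_kerrKiteEndpointSpeedLimit` of the line** (brick of the
landing of K2b-5 `stub_marchingLemma`): the integrated Kerr–Schild speed limit up to a future endpoint —
if the coordinate curve of a future timelike curve of the Kerr star chart `{r > M}` (on an interval)
has the future endpoint `q`, then `‖q̂ − x̂(t₀)‖ ≤ t*(q) − t*(γ t₀)` (anchor of this file, whose content
is the Cauchy property of the level slice in its kite, `KerrKite.kite_cauchy_chart` /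
`KerrKite.isCauchyHypersurface_kite`). [cite: ONeill1983, Ch. 14, Def. 14.28] -/
theorem stub_kerrKiteEndpointSpeedLimit : ∀ [Kerr.Facts] (M a : ℝ) (hM : 0 ≤ M) (γ : ℝ → Kerr.region a M)
    (s : Set ℝ), s.OrdConnected →
    (Kerr.smoothMetric M a M).IsFutureTimelikeCurveOn ((Kerr.timeOrientation M a M hM).ofLE le_top) γ s →
    ∀ (q : E4), HasFutureEndpoint (fun σ => (γ σ : E4)) s q → ∀ t₀ ∈ s,
      ‖E4.spatial q - E4.spatial (γ t₀ : E4)‖ ≤ q 0 - (γ t₀ : E4) 0 :=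
  fun _ _ _ _ _ hs hγ _ hq _ ht₀ => KerrKite.norm_spatial_sub_le_of_hasFutureEndpoint hs hγ hq ht₀

end Summit.FinalStateConjecture.FinalStateConjecture.Theorems.BondiBartnikRigidity.DirectMethod

end
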